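/-
COR-CM (cell pub-hodgecm2, stage 2 of the Hodge ladder) — count-neutral KERNEL COMBINATORICS «census ↔ tree dictionary» (seat
prover-pub-hodgecm2-b23-g32-0, binder prover b23, gen 32; claim INT2-TRANSPORT F1, HOME/lit/LIT-STATUS.md 2026-08-21T15:20:31Z;
sequel of `CorCM/FaceCharacterSaturation.lean` p283784).  Pure combinatorics; theorems only; no geometry, no `Universe`, no
definition, no named fact, nothing asserted.  Seat b30's finite census engine (`Census/FaceSquaresModel.lean` p274598,
`Census/FaceSquaresLattice.lean` p276167) is used BY NAME (`CMGaloisType`, `mem`, `bit`, `imageMask`, `flipAt`, `encode`,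
`normalize`, `isCMType`, `cmTypes`, `placeMask`, `places`, `bar`, `twist`, `faces`, `corners`); nothing of theirs is restated or
re-filed; `Interfaces.lean` (C1), every E term, B01 and `Transposition/*` are untouched.
HONEST FRAMING (COORDINATOR RULING — HODGE FRAMING CORRECTION, 2026-08-21T11:55:35Z): `HC_CM` is NOT proved, here or anywhere in
the tree; this file proves no face period and no generation statement for any particular field.
-/
import Summits.HodgeConjecture.CorCM.FaceCharacterSaturation
import Summits.HodgeConjecture.CorCM.FaceCensusMasks
import HarnessLib

/-!
# The census ↔ tree dictionary: CM types, places and face corners of a Galois CM field read as bitmasks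

Seat b30's kernel census (`Census/FaceSquaresModel.lean`, `Census/OcticFaceSquares*.lean`, …) computes with a Galois CM closure
TYPE `(G, c)` given as a Cayley table `Γ : CMGaloisType n` on `Fin n`, CM types as bitmasks `T < 2^n`, places as the masks
`{g, cg}`, faces as triples of masks.  The tree computes with a Galois CM FIELD `F`: the group `E = GalT F` of Galois translates of
`Hom(F, ℂ)` with complex conjugation `conjT`, abstract CM types `CMF (GalT F) conjT`, and the reads `pullType Θ σ`,
`translate σ π` of `CorCM/CM/LefschetzChar1.lean`.  The DICTIONARY DATUM joining the two is an enumeration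

  `e : GalT F ≃ Fin n` with `e (P * Q) = Γ.mul (e P) (e Q)` and `e conjT = Γ.conj`

(for a concrete field: an isomorphism `Gal(F/ℚ) ≅` the certified Mathlib group of the census file carrying complex conjugation to
`c`, composed with that file's `table_spec`).  An abstract CM type `Ψ` HAS CODE `T` when `T < 2^n ∧ ∀ i, mem i T = true ↔ e⁻¹ i ∈ Ψ`
(written out; no definition is introduced).  With a base embedding `σ₀` this is exactly b30's model convention
«`Hom(F, ℂ) = {σ₀ ∘ g}`, a CM type is the set of `g` with `σ₀ ∘ g ∈ Θ`»: the code of `pullType Θ σ₀`.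

* (§0, the specification lemmas of b30's bitmask primitives, is `CorCM/FaceCensusMasks.lean`.)
* §1 codes: every `Ψ` has a unique code, codes are injective, a code is an `isCMType` mask and every `isCMType` mask is a code;
  `barCM ↦ Γ.bar`, `oflipCM t ↦ flipAt (placeMask (e t))`, change of base embedding `σ₀ ↦ Q σ₀` ↦ `Γ.twist (e Q⁻¹)` (this is
  how Galois twists of faces enter: as base changes), `translate (Q σ₀) ρ = translate σ₀ ρ * Q⁻¹`.
* §2 the code of a tree face `(code (pullType g.Φ σ), placeMask (e (translate σ g.p)), placeMask (e (translate σ g.p′)))` lies in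
  `Γ.faces`.
* §3 the four corner reads of a face (`weightRel_corner_eq_read`) are pairwise distinct and have codes `Γ.corners (code g)`, so the
  corner indicator evaluates through the dictionary: `(weightRel g.corner (fun _ ↦ {σ})) Ψ = 1_{Γ.corners (code g)} (code Ψ)` —
  the left-hand side of b30's certificate identities (`certOK`).

References: [QW8] Def. 2.3 / Thm 2.5 and rfwf v3 §8 (the cell's 2001 sources; kernel `CM/LefschetzChar*`, `Prior/AllgGroup*`);
[cite: Pohlmann1968, Thm. 1]; [cite: Milne1999LefschetzClasses, Thm. 3.2].
-/

noncomputable section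

open NumberField NumberField.ComplexEmbedding
open scoped symmDiff

namespace Summit.HodgeConjecture.CorCM.FaceCensus

open Literature.AlgebraicGeometry.Motives (CMType)
open Literature.NumberTheory.ComplexMultiplication.CMTypeOps
open Summit.HodgeConjecture.CorCM.Prior.AllgGroup.RfwfAllgGroup
open Summit.HodgeConjecture.CorCM.Census.FaceSquaresModel

/-! ## §1 Codes of abstract CM types under an enumeration of the Galois translates -/

section Codes

variable {F : Type} [Field F] [NumberField F] {n : ℕ} (Γ : CMGaloisType n) (e : GalT F ≃ Fin n)

/-- The Cayley table read through the enumeration. [folklore] -/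
theorem mul_eq (hmul : ∀ P Q : GalT F, e (P * Q) = Γ.mul (e P) (e Q)) (i j : Fin n) :
    Γ.mul i j = e (e.symm i * e.symm j) := by
  rw [hmul, e.apply_symm_apply, e.apply_symm_apply]

/-- The Cayley table read through the enumeration is associative. [folklore] -/
theorem mul_mul_eq (hmul : ∀ P Q : GalT F, e (P * Q) = Γ.mul (e P) (e Q)) (i j k : Fin n) :
    Γ.mul (Γ.mul i j) k = Γ.mul i (Γ.mul j k) := by
  simp only [mul_eq Γ e hmul, e.symm_apply_apply, mul_assoc]

/-- Conjugation in the table is `conjT` in the group. [folklore] -/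
theorem conj_mul_eq (hmul : ∀ P Q : GalT F, e (P * Q) = Γ.mul (e P) (e Q)) (hconj : e conjT = Γ.conj) (i : Fin n) :
    Γ.mul Γ.conj i = e (conjT * e.symm i) := by
  rw [hmul, hconj, e.apply_symm_apply]

/-- Conjugation in the table is `conjT` in the group (inverse form). [folklore] -/
theorem symm_conj_mul (hmul : ∀ P Q : GalT F, e (P * Q) = Γ.mul (e P) (e Q)) (hconj : e conjT = Γ.conj) (i : Fin n) :
    e.symm (Γ.mul Γ.conj i) = conjT * e.symm i := by
  rw [conj_mul_eq Γ e hmul hconj, e.symm_apply_apply]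

/-- Conjugation in the table is an involution. [folklore] -/
theorem conj_mul_conj_mul (hmul : ∀ P Q : GalT F, e (P * Q) = Γ.mul (e P) (e Q)) (hconj : e conjT = Γ.conj)
    (i : Fin n) : Γ.mul Γ.conj (Γ.mul Γ.conj i) = i := by
  rw [conj_mul_eq Γ e hmul hconj (Γ.mul Γ.conj i), symm_conj_mul Γ e hmul hconj, conjT_mul_conjT_mul,
    e.apply_symm_apply]

omit Γ in
/-- **Every abstract CM type has a code** (the mask of the indices of its members). [folklore] -/
theorem exists_code (Ψ : CMF (GalT F) conjT) :
    ∃ T : ℕ, T < 2 ^ n ∧ ∀ i : Fin n, mem i T = true ↔ e.symm i ∈ Ψ.1 := by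
  refine ⟨encode (Ψ.1.toList.map e), encode_lt _, fun i => ?_⟩
  rw [mem_encode, List.mem_map]
  constructor
  · rintro ⟨P, hP, rfl⟩
    rw [e.symm_apply_apply]
    exact Finset.mem_toList.mp hP
  · intro h
    exact ⟨e.symm i, Finset.mem_toList.mpr h, e.apply_symm_apply i⟩

omit Γ in
/-- **Codes are injective**: two abstract CM types with a common code are equal. [folklore] -/
theorem eq_of_code_eq {Ψ Ψ' : CMF (GalT F) conjT} {T : ℕ} (h : ∀ i : Fin n, mem i T = true ↔ e.symm i ∈ Ψ.1)
    (h' : ∀ i : Fin n, mem i T = true ↔ e.symm i ∈ Ψ'.1) : Ψ = Ψ' := by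
  apply Subtype.ext
  ext P
  have h1 := h (e P)
  have h2 := h' (e P)
  rw [e.symm_apply_apply] at h1 h2
  rw [← h1, ← h2]

omit Γ in
/-- **Codes are unique**. [folklore] -/
theorem code_eq_of_eq {Ψ : CMF (GalT F) conjT} {T T' : ℕ}
    (hT : T < 2 ^ n ∧ ∀ i : Fin n, mem i T = true ↔ e.symm i ∈ Ψ.1)
    (hT' : T' < 2 ^ n ∧ ∀ i : Fin n, mem i T' = true ↔ e.symm i ∈ Ψ.1) : T = T' :=
  eq_of_mem_iff hT.1 hT'.1 fun i => (hT.2 i).trans (hT'.2 i).symm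

omit Γ in
/-- Two abstract CM types are equal iff their codes are. [folklore] -/
theorem eq_iff_code_eq {Ψ Ψ' : CMF (GalT F) conjT} {T T' : ℕ}
    (hT : T < 2 ^ n ∧ ∀ i : Fin n, mem i T = true ↔ e.symm i ∈ Ψ.1)
    (hT' : T' < 2 ^ n ∧ ∀ i : Fin n, mem i T' = true ↔ e.symm i ∈ Ψ'.1) : Ψ = Ψ' ↔ T = T' := by
  constructor
  · rintro rfl
    exact code_eq_of_eq e hT hT'
  · rintro rfl
    exact eq_of_code_eq e hT.2 hT'.2

/-- **A code is a CM type of the model** (`isCMType`). [folklore] -/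
theorem isCMType_of_code (hmul : ∀ P Q : GalT F, e (P * Q) = Γ.mul (e P) (e Q)) (hconj : e conjT = Γ.conj)
    {Ψ : CMF (GalT F) conjT} {T : ℕ} (hT : T < 2 ^ n ∧ ∀ i : Fin n, mem i T = true ↔ e.symm i ∈ Ψ.1) :
    Γ.isCMType T = true := by
  unfold CMGaloisType.isCMType
  rw [Bool.and_eq_true, decide_eq_true_iff, List.all_eq_true]
  refine ⟨hT.1, fun i _ => ?_⟩
  rw [bne_iff_ne, ne_eq]
  intro h
  have h1 := hT.2 i
  have h2 := hT.2 (Γ.mul Γ.conj i)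
  rw [symm_conj_mul Γ e hmul hconj] at h2
  have hcm := Ψ.2 (e.symm i)
  rw [← h1, ← h2, h] at hcm
  exact iff_not_self hcm

/-- The code of a CM type lies in the model's list of CM types. [folklore] -/
theorem code_mem_cmTypes (hmul : ∀ P Q : GalT F, e (P * Q) = Γ.mul (e P) (e Q)) (hconj : e conjT = Γ.conj)
    {Ψ : CMF (GalT F) conjT} {T : ℕ} (hT : T < 2 ^ n ∧ ∀ i : Fin n, mem i T = true ↔ e.symm i ∈ Ψ.1) :
    T ∈ Γ.cmTypes :=
  (mem_cmTypes_iff Γ T).mpr ⟨hT.1, isCMType_of_code Γ e hmul hconj hT⟩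

/-- **Every CM type of the model is a code** (surjectivity of the dictionary onto `isCMType` masks). [folklore] -/
theorem exists_of_isCMType (hmul : ∀ P Q : GalT F, e (P * Q) = Γ.mul (e P) (e Q)) (hconj : e conjT = Γ.conj)
    {T : ℕ} (hT : Γ.isCMType T = true) :
    ∃ Ψ : CMF (GalT F) conjT, T < 2 ^ n ∧ ∀ i : Fin n, mem i T = true ↔ e.symm i ∈ Ψ.1 := by
  unfold CMGaloisType.isCMType at hT
  rw [Bool.and_eq_true, decide_eq_true_iff, List.all_eq_true] at hT
  classical
  refine ⟨⟨Finset.univ.filter (fun P => mem (e P) T = true), fun P => ?_⟩, hT.1, fun i => ?_⟩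
  · simp only [Finset.mem_filter, Finset.mem_univ, true_and]
    have h := hT.2 (e P) (List.mem_finRange _)
    rw [bne_iff_ne, ne_eq, conj_mul_eq Γ e hmul hconj, e.symm_apply_apply] at h
    constructor
    · intro h1 h2
      exact h (h1.trans h2.symm)
    · intro h2
      cases h1 : mem (e P) T
      · exfalso
        apply h
        rw [h1]
        cases h3 : mem (e (conjT * P)) T
        · rfl
        · exact absurd h3 h2
      · rfl
  · simp only [Finset.mem_filter, Finset.mem_univ, true_and, e.apply_symm_apply]

/-- Membership in the conjugate mask. [folklore] -/
theorem mem_bar (hmul : ∀ P Q : GalT F, e (P * Q) = Γ.mul (e P) (e Q)) (hconj : e conjT = Γ.conj) (T : ℕ) (k : Fin n) :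
    mem k (Γ.bar T) = true ↔ mem (Γ.mul Γ.conj k) T = true := by
  unfold CMGaloisType.bar
  rw [mem_imageMask]
  constructor
  · rintro ⟨i, hi, rfl⟩
    rwa [conj_mul_conj_mul Γ e hmul hconj]
  · intro h
    exact ⟨Γ.mul Γ.conj k, h, conj_mul_conj_mul Γ e hmul hconj k⟩

/-- **Dictionary: conjugate type ↦ conjugate mask.** [folklore] -/
theorem code_bar (hmul : ∀ P Q : GalT F, e (P * Q) = Γ.mul (e P) (e Q)) (hconj : e conjT = Γ.conj)
    {Ψ : CMF (GalT F) conjT} {T : ℕ} (hT : T < 2 ^ n ∧ ∀ i : Fin n, mem i T = true ↔ e.symm i ∈ Ψ.1) :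
    Γ.bar T < 2 ^ n ∧ ∀ i : Fin n, mem i (Γ.bar T) = true ↔ e.symm i ∈ (barCM Ψ).1 := by
  refine ⟨imageMask_lt _ _, fun i => ?_⟩
  rw [mem_bar Γ e hmul hconj, hT.2, symm_conj_mul Γ e hmul hconj, mem_barCM]
  have h := Ψ.2 (conjT * e.symm i)
  rw [conjT_mul_conjT_mul] at h
  exact h

/-- **Dictionary: flip at the place of `t` ↦ `flipAt (placeMask (e t))`.** [folklore] -/
theorem code_oflip (hmul : ∀ P Q : GalT F, e (P * Q) = Γ.mul (e P) (e Q)) (hconj : e conjT = Γ.conj)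
    {Ψ : CMF (GalT F) conjT} {T : ℕ} (hT : T < 2 ^ n ∧ ∀ i : Fin n, mem i T = true ↔ e.symm i ∈ Ψ.1)
    (t : GalT F) :
    flipAt (Γ.placeMask (e t)) T < 2 ^ n ∧ ∀ i : Fin n,
      mem i (flipAt (Γ.placeMask (e t)) T) = true ↔ e.symm i ∈ (oflipCM conjT conjT_mul_self t Ψ).1 := by
  refine ⟨flipAt_lt (placeMask_lt Γ _) hT.1, fun i => ?_⟩
  rw [mem_flipAt]
  change _ ↔ e.symm i ∈ Ψ.1 ∆ orb conjT t
  rw [Finset.mem_symmDiff, mem_orb]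
  have h1 := hT.2 i
  have h2 : mem i (Γ.placeMask (e t)) = true ↔ e.symm i = t ∨ e.symm i = conjT * t := by
    rw [mem_placeMask, conj_mul_eq Γ e hmul hconj, e.symm_apply_apply]
    constructor
    · rintro (rfl | rfl)
      · exact Or.inl (e.symm_apply_apply t)
      · exact Or.inr (e.symm_apply_apply _)
    · rintro (h | h)
      · left; rw [← h, e.apply_symm_apply]
      · right; rw [← h, e.apply_symm_apply]
  rcases hb : mem i T with _ | _ <;> rcases hb' : mem i (Γ.placeMask (e t)) with _ | _ <;> simp_all

omit Γ e in
/-- `Q⁻¹` undoes `Q` on embeddings. [folklore] -/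
theorem inv_apply_apply (Q : GalT F) (σ : F →+* ℂ) : Q⁻¹.1 (Q.1 σ) = σ := by
  rw [← GalT.mul_apply, inv_mul_cancel, GalT.one_apply]

/-- **Dictionary: change of base embedding `σ₀ ↦ Q σ₀` ↦ Galois twist `Γ.twist (e Q⁻¹)`.**  (This is how the Galois twists of
the census enter the tree: reading the SAME CM type at another base embedding.) [folklore] -/
theorem code_pullType_baseChange (hmul : ∀ P Q : GalT F, e (P * Q) = Γ.mul (e P) (e Q)) (Θ : CMType F) (σ₀ : F →+* ℂ)
    (Q : GalT F) {T : ℕ} (hT : T < 2 ^ n ∧ ∀ i : Fin n, mem i T = true ↔ e.symm i ∈ (pullType Θ σ₀).1) :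
    Γ.twist (e Q⁻¹) T < 2 ^ n ∧ ∀ i : Fin n, mem i (Γ.twist (e Q⁻¹) T) = true ↔ e.symm i ∈ (pullType Θ (Q.1 σ₀)).1 := by
  refine ⟨imageMask_lt _ _, fun k => ?_⟩
  unfold CMGaloisType.twist
  rw [mem_imageMask, mem_pullType]
  constructor
  · rintro ⟨i, hi, hik⟩
    rw [mul_eq Γ e hmul, e.symm_apply_apply] at hik
    have hk : e.symm k = e.symm i * Q⁻¹ := by rw [← hik, e.symm_apply_apply]
    rw [hk, GalT.mul_apply, inv_apply_apply, ← mem_pullType]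
    exact (hT.2 i).mp hi
  · intro hk
    refine ⟨e (e.symm k * Q), ?_, ?_⟩
    · rw [hT.2, e.symm_apply_apply, mem_pullType, GalT.mul_apply]
      exact hk
    · rw [mul_eq Γ e hmul, e.symm_apply_apply, e.symm_apply_apply, mul_inv_cancel_right, e.apply_symm_apply]

omit Γ e in
/-- **Translates at another base embedding**: `translate (Q σ₀) ρ = translate σ₀ ρ * Q⁻¹`. [folklore] -/
theorem translate_baseChange [IsGalois ℚ F] (σ₀ ρ : F →+* ℂ) (Q : GalT F) :
    translate (Q.1 σ₀) ρ = translate σ₀ ρ * Q⁻¹ :=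
  GalT.ext_of_apply (Q.1 σ₀) (by rw [translate_apply_self, GalT.mul_apply, inv_apply_apply, translate_apply_self])

/-- The place mask of a product is the twisted place mask. [folklore] -/
theorem placeMask_mul (hmul : ∀ P Q : GalT F, e (P * Q) = Γ.mul (e P) (e Q)) (i j : Fin n) :
    Γ.placeMask (Γ.mul i j) = Γ.twist j (Γ.placeMask i) := by
  apply eq_of_mem_iff (placeMask_lt Γ _) (imageMask_lt _ _)
  intro k
  show mem k (Γ.placeMask (Γ.mul i j)) = true ↔ mem k (imageMask (fun i => Γ.mul i j) (Γ.placeMask i)) = true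
  rw [mem_placeMask, mem_imageMask]
  simp only [mem_placeMask]
  have hassoc : Γ.mul (Γ.mul Γ.conj i) j = Γ.mul Γ.conj (Γ.mul i j) := mul_mul_eq Γ e hmul _ _ _
  constructor
  · rintro (rfl | rfl)
    · exact ⟨i, Or.inl rfl, rfl⟩
    · exact ⟨Γ.mul Γ.conj i, Or.inr rfl, hassoc⟩
  · rintro ⟨i', hi' | hi', rfl⟩
    · exact Or.inl (by rw [hi'])
    · exact Or.inr (by rw [hi', hassoc])

/-- **Dictionary: the place of a translate at another base embedding is the twisted place.** [folklore] -/
theorem placeMask_translate_baseChange [IsGalois ℚ F] (hmul : ∀ P Q : GalT F, e (P * Q) = Γ.mul (e P) (e Q))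
    (σ₀ ρ : F →+* ℂ) (Q : GalT F) :
    Γ.placeMask (e (translate (Q.1 σ₀) ρ)) = Γ.twist (e Q⁻¹) (Γ.placeMask (e (translate σ₀ ρ))) := by
  rw [translate_baseChange, hmul, placeMask_mul Γ e hmul]

/-! ## §2 The code of a tree face is a face of the model -/

/-- Distinct places have distinct place masks. [folklore] -/
theorem placeMask_ne_of_notMem_orb (hmul : ∀ P Q : GalT F, e (P * Q) = Γ.mul (e P) (e Q)) (hconj : e conjT = Γ.conj)
    {t t' : GalT F} (ht' : t' ∉ orb conjT t) : Γ.placeMask (e t') ≠ Γ.placeMask (e t) := by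
  intro h
  apply ht'
  have hm : mem (e t') (Γ.placeMask (e t')) = true := (mem_placeMask Γ _ _).mpr (Or.inl rfl)
  rw [h, mem_placeMask, conj_mul_eq Γ e hmul hconj, e.symm_apply_apply] at hm
  rw [mem_orb]
  rcases hm with hm | hm
  · exact Or.inl (e.injective hm)
  · exact Or.inr (e.injective hm)

/-- **The code of a tree face `g` read at `σ` — `(code (pullType g.Φ σ), placeMask (e (translate σ g.p)),
placeMask (e (translate σ g.p′)))` — is a face of the model.** [folklore] -/
theorem faceCode_mem_faces [IsGalois ℚ F] (hmul : ∀ P Q : GalT F, e (P * Q) = Γ.mul (e P) (e Q))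
    (hconj : e conjT = Γ.conj) (g : Face F) (σ : F →+* ℂ) {T : ℕ}
    (hT : T < 2 ^ n ∧ ∀ i : Fin n, mem i T = true ↔ e.symm i ∈ (pullType g.Φ σ).1) :
    (T, Γ.placeMask (e (translate σ g.p)), Γ.placeMask (e (translate σ g.p'))) ∈ Γ.faces :=
  mem_faces_of Γ (code_mem_cmTypes Γ e hmul hconj hT) (placeMask_mem_places Γ _) (placeMask_mem_places Γ _)
    (placeMask_ne_of_notMem_orb Γ e hmul hconj (Face.translate_notMem_orb g σ))

/-! ## §3 The corner indicator of a face evaluates through the dictionary -/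

omit Γ e in
/-- Places are symmetric: `t ∈ {t′, c t′} → t′ ∈ {t, c t}`. [folklore] -/
theorem mem_orb_comm {t t' : GalT F} (h : t ∈ orb conjT t') : t' ∈ orb conjT t := by
  rw [mem_orb] at h ⊢
  rcases h with rfl | rfl
  · exact Or.inl rfl
  · exact Or.inr (conjT_mul_conjT_mul t').symm

omit Γ e in
/-- **The four corner reads of a face are pairwise distinct** (`Φ′`, `Φ̄′^{(t)}`, `Φ̄′^{(t′)}`, `Φ′^{(tt′)}` over two distinct
places; the group then has order `≥ 4`). [folklore] -/
theorem reads_ne (Φ' : CMF (GalT F) conjT) {t t' : GalT F} (ht' : t' ∉ orb conjT t) :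
    Φ' ≠ oflipCM conjT conjT_mul_self t (barCM Φ') ∧
    Φ' ≠ oflipCM conjT conjT_mul_self t' (barCM Φ') ∧
    Φ' ≠ oflipCM conjT conjT_mul_self t' (oflipCM conjT conjT_mul_self t Φ') ∧
    oflipCM conjT conjT_mul_self t (barCM Φ') ≠ oflipCM conjT conjT_mul_self t' (barCM Φ') ∧
    oflipCM conjT conjT_mul_self t (barCM Φ') ≠ oflipCM conjT conjT_mul_self t' (oflipCM conjT conjT_mul_self t Φ') ∧
    oflipCM conjT conjT_mul_self t' (barCM Φ') ≠ oflipCM conjT conjT_mul_self t' (oflipCM conjT conjT_mul_self t Φ') := by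
  have hO : orb conjT t ≠ orb conjT t' := fun h => ht' (h ▸ (mem_orb conjT).mpr (Or.inl rfl))
  have hOtop : (⊤ : Finset (GalT F)) ≠ orb conjT t := fun h => ht' (h ▸ Finset.mem_univ t')
  have hO'top : (⊤ : Finset (GalT F)) ≠ orb conjT t' := fun h => ht' (mem_orb_comm (h ▸ Finset.mem_univ t))
  have hbar : (barCM Φ').1 = Φ'.1 ∆ ⊤ := by
    change Finset.univ \ Φ'.1 = _
    rw [← Finset.compl_eq_univ_sdiff, symmDiff_top]
  have e1 : (oflipCM conjT conjT_mul_self t (barCM Φ')).1 = Φ'.1 ∆ (⊤ ∆ orb conjT t) := by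
    change (barCM Φ').1 ∆ orb conjT t = _
    rw [hbar, symmDiff_assoc]
  have e2 : (oflipCM conjT conjT_mul_self t' (barCM Φ')).1 = Φ'.1 ∆ (⊤ ∆ orb conjT t') := by
    change (barCM Φ').1 ∆ orb conjT t' = _
    rw [hbar, symmDiff_assoc]
  have e3 : (oflipCM conjT conjT_mul_self t' (oflipCM conjT conjT_mul_self t Φ')).1 = Φ'.1 ∆ (orb conjT t ∆ orb conjT t') := by
    change (Φ'.1 ∆ orb conjT t) ∆ orb conjT t' = _
    rw [symmDiff_assoc]
  refine ⟨?_, ?_, ?_, ?_, ?_, ?_⟩ <;> intro h <;> have h' := congrArg Subtype.val h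
  · rw [e1, eq_comm, symmDiff_eq_left, symmDiff_eq_bot] at h'
    exact hOtop h'
  · rw [e2, eq_comm, symmDiff_eq_left, symmDiff_eq_bot] at h'
    exact hO'top h'
  · rw [e3, eq_comm, symmDiff_eq_left, symmDiff_eq_bot] at h'
    exact hO h'
  · rw [e1, e2, symmDiff_right_inj, symmDiff_right_inj] at h'
    exact hO h'
  · rw [e1, e3, symmDiff_right_inj, symmDiff_comm (orb conjT t) (orb conjT t'), symmDiff_left_inj] at h'
    exact hO'top h'
  · rw [e2, e3, symmDiff_right_inj, symmDiff_left_inj] at h'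
    exact hOtop h'

/-- **The corner indicator of a face evaluates through the dictionary.**  For a tree face `g` read at `σ` with type code `T`,
place codes `p = placeMask (e (translate σ g.p))`, `q = placeMask (e (translate σ g.p′))`, and any abstract CM type `Ψ` with
code `S`: `(weightRel g.corner (fun _ ↦ {σ})) Ψ = 1` if `S ∈ Γ.corners (T, p, q)` and `0` otherwise — the left-hand side of
seat b30's certificate identities. [cite: Pohlmann1968, Thm. 1] -/
theorem weightRel_corner_apply [IsGalois ℚ F] (hmul : ∀ P Q : GalT F, e (P * Q) = Γ.mul (e P) (e Q))
    (hconj : e conjT = Γ.conj) (g : Face F) (σ : F →+* ℂ) {T : ℕ}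
    (hT : T < 2 ^ n ∧ ∀ i : Fin n, mem i T = true ↔ e.symm i ∈ (pullType g.Φ σ).1)
    (Ψ : CMF (GalT F) conjT) {S : ℕ} (hS : S < 2 ^ n ∧ ∀ i : Fin n, mem i S = true ↔ e.symm i ∈ Ψ.1) :
    weightRel g.corner (fun _ => ({σ} : Finset (F →+* ℂ))) Ψ =
      if (Γ.corners (T, Γ.placeMask (e (translate σ g.p)), Γ.placeMask (e (translate σ g.p')))).contains S
      then 1 else 0 := by
  have h1 := code_oflip Γ e hmul hconj (code_bar Γ e hmul hconj hT) (translate σ g.p)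
  have h2 := code_oflip Γ e hmul hconj (code_bar Γ e hmul hconj hT) (translate σ g.p')
  have h3 := code_oflip Γ e hmul hconj (code_oflip Γ e hmul hconj hT (translate σ g.p)) (translate σ g.p')
  obtain ⟨n01, n02, n03, n12, n13, n23⟩ := reads_ne (pullType g.Φ σ) (Face.translate_notMem_orb g σ)
  rw [weightRel_corner_eq_read, ← oflipCM_barCM, ← oflipCM_barCM]
  simp only [Finsupp.add_apply, Finsupp.single_apply]
  rw [ite_add_four (fun h => n01 (h.1.trans h.2.symm)) (fun h => n02 (h.1.trans h.2.symm))
    (fun h => n03 (h.1.trans h.2.symm)) (fun h => n12 (h.1.trans h.2.symm)) (fun h => n13 (h.1.trans h.2.symm))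
    (fun h => n23 (h.1.trans h.2.symm))]
  have hc : (Γ.corners (T, Γ.placeMask (e (translate σ g.p)), Γ.placeMask (e (translate σ g.p')))).contains S = true ↔
      (pullType g.Φ σ = Ψ ∨ oflipCM conjT conjT_mul_self (translate σ g.p) (barCM (pullType g.Φ σ)) = Ψ ∨
        oflipCM conjT conjT_mul_self (translate σ g.p') (barCM (pullType g.Φ σ)) = Ψ ∨
        oflipCM conjT conjT_mul_self (translate σ g.p') (oflipCM conjT conjT_mul_self (translate σ g.p) (pullType g.Φ σ)) = Ψ) := by
    rw [List.contains_iff_mem]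
    change S ∈ [T, flipAt (Γ.placeMask (e (translate σ g.p))) (Γ.bar T), flipAt (Γ.placeMask (e (translate σ g.p'))) (Γ.bar T),
      flipAt (Γ.placeMask (e (translate σ g.p'))) (flipAt (Γ.placeMask (e (translate σ g.p))) T)] ↔ _
    simp only [List.mem_cons, List.not_mem_nil, or_false]
    rw [eq_iff_code_eq e hT hS, eq_iff_code_eq e h1 hS, eq_iff_code_eq e h2 hS, eq_iff_code_eq e h3 hS]
    simp only [eq_comm]
  by_cases h : (pullType g.Φ σ = Ψ ∨ oflipCM conjT conjT_mul_self (translate σ g.p) (barCM (pullType g.Φ σ)) = Ψ ∨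
      oflipCM conjT conjT_mul_self (translate σ g.p') (barCM (pullType g.Φ σ)) = Ψ ∨
      oflipCM conjT conjT_mul_self (translate σ g.p') (oflipCM conjT conjT_mul_self (translate σ g.p) (pullType g.Φ σ)) = Ψ)
  · rw [if_pos h, if_pos (hc.mpr h)]
  · rw [if_neg h, if_neg (fun h' => h (hc.mp h'))]

end Codes

end Summit.HodgeConjecture.CorCM.FaceCensus

end
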